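import Summits.PneNP.PneNP.Theorems.RootDecompSegregatorSmallSegregators.Negative.KSS5

/-!
# K\*\* — proofs 6/6 (`KSS6`)

Proof file 6/6 of the kernel refutation of the route item `RootDecompSegregator.SmallSegregators`
(stmt-PneNP-26297; deciding theorem `Summit.PneNP.PneNP.Theorems.RootDecompSegregatorSmallSegregators_refuted`
in `Theorems/RootDecompSegregatorSmallSegregatorsRefutation.lean`; definitions in `Defs.lean` of this
directory).  Topic: lemmas `decode_tQ` … `ancestorRobust_three`.

PROVENANCE.  Mathematics and Lean text by the decomp-pnenp cell's lens-1 lineage (work file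
`decomp-pnenp-lens-1/SegregatorPageThreshold.lean`, generations 4–5, v5 sha256 `099856e2…`, brief
`KSS-DoubleButterfly.md`): the dependency cone of its theorem `not_smallSegregators`, extracted verbatim by
the cell critic and split into files of at most 400 lines (docstrings added where missing).  No declaration
here mentions a Theses item; the chain ends in `ancestorRobust_three : AncestorRobust 3 160 12` (last file),
from which the flat refutation file concludes `¬ SmallSegregators` by the kill switch
`not_smallSegregatorsAt_of_ancestorRobust` at `r = 3`, `k = 172`.
-/

namespace Summit.PneNP.PneNP.Theorems.RootDecompSegregatorSmallSegregators.Negative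

open Relation
open StackOp

namespace TSB

section Layout
open Relation
variable {L : ℕ}

/-- K\*\* cone (auxiliary lemma): `decode_tQ`. -/
theorem decode_tQ (hL : 1 ≤ L) (lam : ℕ) {x : ℕ} (hx : x < 2 ^ L) : decode L (tQ L lam x) = (lam, x) := by
  have hq := posOf_lt (L := L) (lam := lam) hx
  obtain ⟨hqd, hi, hjB, _⟩ := block_decomp hL lam hq
  rw [tQ, base, add_assoc (2 ^ L + 3 * 2 ^ L * lam + 3 * bsz L lam * (posOf L lam x / bsz L lam)),
    add_assoc (2 ^ L + 3 * 2 ^ L * lam),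
    decode_time L lam (off_lt hL lam hq (by omega)), decodeAux_Q L lam (by omega),
    show bsz L lam - 1 - (bsz L lam - 1 - posOf L lam x % bsz L lam) = posOf L lam x % bsz L lam by omega,
    hqd, posOf_posOf hx]

/-- K\*\* cone (auxiliary lemma): `decode_tC`. -/
theorem decode_tC (hL : 1 ≤ L) (lam : ℕ) {x : ℕ} (hx : x < 2 ^ L) :
    decode L (tC L lam x) = (lam + 1, x) := by
  have hq := posOf_lt (L := L) (lam := lam) hx
  obtain ⟨hqd, hi, hjB, _⟩ := block_decomp hL lam hq
  rw [tC, base, add_assoc (2 ^ L + 3 * 2 ^ L * lam + 3 * bsz L lam * (posOf L lam x / bsz L lam)),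
    add_assoc (2 ^ L + 3 * 2 ^ L * lam),
    decode_time L lam (off_lt hL lam hq (by omega)), decodeAux_C L lam hi, hqd, posOf_posOf hx]

/-- K\*\* cone (auxiliary lemma): `decode_beta`. -/
theorem decode_beta (hL : 1 ≤ L) {lam x : ℕ} (hx : x < 2 ^ L) : decode L (beta L lam x) = (lam, x) := by
  rcases Nat.eq_zero_or_pos lam with rfl | hpos
  · rw [beta_zero]; unfold decode; rw [if_pos hx]
  · obtain ⟨l, rfl⟩ : ∃ l, lam = l + 1 := ⟨lam - 1, by omega⟩
    rw [beta_succ, decode_tC hL l hx]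

/-- K\*\* cone (auxiliary lemma): `charge_field`. -/
theorem charge_field (hL : 1 ≤ L) (t : ℕ) :
    (((Finset.range (2 * L + 1)) ×ˢ (Finset.range (2 ^ L))).filter
      (fun p => t = beta L p.1 p.2 ∨ t ∈ carrier L p.1 p.2)).card ≤ 1 := by
  refine Finset.card_le_one.2 (fun a ha b hb => ?_)
  simp only [Finset.mem_filter, Finset.mem_product, Finset.mem_range, carrier,
    Finset.mem_insert, Finset.mem_singleton] at ha hb
  have key : ∀ p : ℕ × ℕ, p.2 < 2 ^ L →
      (t = beta L p.1 p.2 ∨ t = tP L p.1 p.2 ∨ t = tQ L p.1 p.2) → decode L t = p := by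
    rintro ⟨lam, x⟩ hx (h | h | h) <;> simp only at hx h ⊢ <;> rw [h]
    exacts [decode_beta hL hx, decode_tP hL lam hx, decode_tQ hL lam hx]
  rw [← key a ha.1.2 ha.2, ← key b hb.1.2 hb.2]

/-- THE LAYOUT, in kernel: the triple-stack butterfly schedule carries a charged `DB(L)` system of charge 1. -/
theorem chargedDB_one (hL : 1 ≤ L) : Nonempty (ChargedDB L (dbT L) 1 (tbGraph L)) :=
  ⟨{ β := beta L
     carrier := carrier L
     β_lt := fun _ _ hlam hx => beta_lt hL hlam hx
     path := path_field hL
     charge := charge_field hL }⟩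

end Layout

end TSB

/-! #### K\*\* assembled: `¬ SmallSegregators`, unconditionally -/

/-- The reduction of `ancestorRobust_of_chargedDB`, for an arbitrary step graph. -/
theorem ancestorRobust_of_dbLayoutIn {κ : ℕ} (hLay : DBLayoutIn κ) :
    AncestorRobust 3 (160 * κ) (12 * κ) := by
  intro N₀
  obtain ⟨E, hE, ⟨D⟩⟩ := hLay (max N₀ 5) (le_max_right _ _)
  set L := max N₀ 5 with hLdef
  have hL5 : 5 ≤ L := le_max_right _ _
  have hLN : N₀ ≤ L := le_max_left _ _
  have h2 : L < 2 ^ L := Nat.lt_two_pow_self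
  have hML5 : 2 ^ L * 5 ≤ 2 ^ L * L := Nat.mul_le_mul_left _ hL5
  have hM : 0 < 2 ^ L := Nat.two_pow_pos L
  refine ⟨dbT L, ?_, E, hE, fun J hJ => ?_⟩
  · rw [dbT_eq]; linarith [Nat.zero_le (2 ^ L * L)]
  · have hell : L + 4 ≤ ell (dbT L) := ell_dbT_ge (by omega)
    have hTle : dbT L ≤ 10 * 2 ^ L * (L + 4) := by
      rw [dbT_eq, show 10 * 2 ^ L * (L + 4) = 10 * (2 ^ L * L) + 40 * 2 ^ L by ring]; omega
    have h1 : 160 * κ * (J.card * (L + 4)) ≤ 160 * κ * (J.card * ell (dbT L)) :=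
      Nat.mul_le_mul_left _ (Nat.mul_le_mul_left _ hell)
    have h3 : 160 * κ * (J.card * (L + 4)) ≤ 10 * 2 ^ L * (L + 4) := le_trans h1 (le_trans hJ hTle)
    have e1 : 160 * κ * (J.card * (L + 4)) = (16 * κ * J.card) * (10 * (L + 4)) := by ring
    have e2 : 10 * 2 ^ L * (L + 4) = 2 ^ L * (10 * (L + 4)) := by ring
    rw [e1, e2] at h3
    have hJM : 16 * κ * J.card ≤ 2 ^ L := Nat.le_of_mul_le_mul_right h3 (by omega)
    obtain ⟨o, ho, hoJ, hcnt⟩ := dbCount κ L (dbT L) E D J hL5 hJM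
    refine ⟨D.β (2 * L) o, D.β_lt _ _ le_rfl ho, hoJ, ?_⟩
    have e3 : 7 * 2 ^ L * L = 7 * (2 ^ L * L) := by ring
    rw [e3] at hcnt
    have key : 10 * (2 ^ L * L) + 2 * 2 ^ L < 12 * κ * (ancestorsAvoiding E J (D.β (2 * L) o)).ncard := by
      linarith [hcnt, hML5, hM]
    calc dbT L = 10 * (2 ^ L * L) + 2 * 2 ^ L := dbT_eq L
      _ < _ := key

/-- K\*\* cone (auxiliary lemma): `TSB.isMultiPushdownGraph_tbGraph`. -/
theorem TSB.isMultiPushdownGraph_tbGraph {L : ℕ} (hL : 1 ≤ L) :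
    IsMultiPushdownGraph 3 (dbT L) (TSB.tbGraph L) :=
  isMultiPushdownGraph_traceGraph (TSB.length_trU hL) (TSB.length_trX hL 0) (TSB.length_trX hL 1)

/-- THE LAYOUT LEMMA, kernel: charge 1, three pushdowns. -/
theorem dbLayoutIn_one : DBLayoutIn 1 := fun L hL =>
  ⟨TSB.tbGraph L, TSB.isMultiPushdownGraph_tbGraph (by omega), TSB.chargedDB_one (by omega)⟩

/-- **`AncestorRobust 3 160 12`** — a constant-page (r = 3) ancestor-robust family at Piece A's budget. -/
theorem ancestorRobust_three : AncestorRobust 3 160 12 := by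
  simpa using ancestorRobust_of_dbLayoutIn dbLayoutIn_one

end Summit.PneNP.PneNP.Theorems.RootDecompSegregatorSmallSegregators.Negative
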